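import Summits.HodgeConjecture.HodgeConjecture.Theorems.BoundaryReadoutPullbackAlgebraicBundleLerayHirsch
import Summits.HodgeConjecture.HodgeConjecture.Theorems.BoundaryReadoutPullbackAlgebraicLerayHirschReadout
import Summits.HodgeConjecture.HodgeConjecture.Theorems.BoundaryReadoutPullbackAlgebraic
import Literature.AlgebraicGeometry.HodgeTheory.HodgeClassLiftRationalHodgeMaps
import Literature.AlgebraicGeometry.HodgeTheory.HodgeTypeExteriorProduct
import Literature.AlgebraicGeometry.HodgeTheory.AlgebraicClassesHodgeTypeHolds
import Literature.AlgebraicGeometry.HodgeTheory.HyperplaneClassRational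
import Literature.AlgebraicGeometry.HodgeTheory.HardLefschetzThreefold
import Literature.AlgebraicGeometry.HodgeTheory.ChernCharacterBetti
import Literature.AlgebraicGeometry.HodgeTheory.HodgeConjecture
import Literature.AlgebraicGeometry.HodgeTheory.HodgeRiemannPolarizabilityProofs
import Literature.AlgebraicGeometry.HodgeTheory.LefschetzOneOneHolds
import Literature.AlgebraicGeometry.HodgeTheory.HodgeClassesBlowupBirationalInvarianceProofs
import Literature.AlgebraicGeometry.HodgeTheory.CellularVarietyAlgebraicClasses
import Literature.AlgebraicGeometry.HodgeTheory.HypersurfaceSectionHodgeConjecture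
import Literature.AlgebraicGeometry.Resolution.ZariskiProjectiveBundle
import HarnessLib

/-!
# The Hodge conjecture is stable under Zariski projective bundles: `HC(X) ⟺ HC(E)`

For `q : E ⟶ X` Zariski-locally over `X` isomorphic to `U ⊗ ℙʳ → U` (the local-triviality clause of
`PullbackAlgebraicNormalCone.stub_bundleLerayHirsch`, the tree predicate
`Literature.AlgebraicGeometry.Resolution.IsZariskiProjectiveBundle r q`), with `X`
and `E` smooth projective of dimensions `n` and `n + r`:
`HodgeConjectureFor n X ↔ HodgeConjectureFor (n + r) E` (`projectiveBundleClosure`) — no hypothesis, no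
named fact (this file is definition-free: the closure rule is stated as that theorem). [cite: VoisinHodgeI2002, Lemma 7.32] [cite: Lazarsfeld2004PositivityII, Ex. 7.1.5]

* §PB  (⇒) Leray–Hirsch expansion (`BundleLerayHirsch.exists_expansion`) with a RATIONAL divisor class
  `ζ = emb^* h` (`exists_isRationalClass_lhClass`), Voisin's Hodge-class lift for the jointly surjective
  family of rational Hodge maps `x ↦ q^* x ∪ ζᵇ` (`exists_isRationalClass_isOfHodgeType_eq_sum`), `HC(X)`,
  Fulton pull-back (`fulton1998_map_mem_algebraicClasses_holds`) and divisor cups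
  (`cupProduct_cupPowTwo_mem_algebraicClasses`); cup products preserve Hodge types by
  `cupPreservesHodgeType_of_hodgeModel`. (⇐) `q^*` of a rational `(p,p)` class is algebraic by `HC(E)`,
  then the one-term readout `lerayHirschCoeff_mem_algebraicClasses`.
* §Rungs  bundles over bases of dimension `≤ 3`, over `ℙᴺ`, two-step towers, descent — all unconditional.
* §HOM  bundles over cellular varieties / Grassmannians, and the Lefschetz-package cores of
  `HypersurfaceSectionHC` with a cellular or Grassmannian ambient — modulo the named facts of
  `CellularVarietyAlgebraicClasses` (Fulton Ex. 19.1.11 (b), (d)).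
* §NV  the clause is not vacuous: the trivial bundle `fst : X ⊗ ℙʳ ⟶ X` satisfies it (the tree's
  `Literature.AlgebraicGeometry.Resolution.isZariskiProjectiveBundle_fst`), whence `HC(X) ⟺ HC(X ⊗ ℙʳ)`.

Origin: cell `hodge-nonav`, seats p1 g18/g20, `HOME/memos/ROUTE-P1Q-ADD1.md` (landing ask A12 v2: the
bundle predicate is imported from `Literature/AlgebraicGeometry/Resolution/ZariskiProjectiveBundle.lean`;
`--supports stmt-HodgeConjecture-19654`).
-/

set_option linter.dupNamespace false

noncomputable section

open CategoryTheory AlgebraicGeometry MonoidalCategory CartesianMonoidalCategory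
  Literature.AlgebraicGeometry Literature.AlgebraicGeometry.Motives
  Literature.AlgebraicGeometry.HodgeTheory
open Literature.AlgebraicTopology.SingularHomology
open Literature.AlgebraicTopology.CharacteristicClasses (cupPow cupPow_zero cupPow_succ)
open Summit.HodgeConjecture.HodgeConjecture.Theorems
open Summit.HodgeConjecture.HodgeConjecture.Theorems.PullbackAlgebraicNormalCone
open scoped Manifold

namespace Summit.HodgeConjecture.HodgeConjecture.Theorems.ProjectiveBundleHC

open Literature.AlgebraicGeometry.Resolution (IsZariskiProjectiveBundle isZariskiProjectiveBundle_fst)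

/-- **A rational algebraic divisor class on `E` restricting non-trivially along every closed immersion
`ℙʳ ⟶ E` (`r ≥ 1`)**: `ζ = emb^* h` for a projective embedding `emb : E ⟶ ℙᴺ` and the rational generator
`h` of `H²(ℙᴺ(ℂ); ℂ)`. [cite: VoisinHodgeI2002, §7.1.1 and Lemma 7.32] -/
theorem exists_isRationalClass_lhClass {n r : ℕ} {E : SchemeOver ℂ} (hE : IsSmoothProjective (n + r) E) :
    ∃ ζ : complexBetti E 2, IsRationalClass ζ ∧ ζ ∈ algebraicClasses E 1 ∧
      (1 ≤ r → ∀ ι : Motives.projectiveSpace r ℂ ⟶ E, IsClosedImmersion ι.left →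
        complexBetti.map ι 2 ζ ≠ 0) := by
  obtain ⟨N, emb, hemb⟩ := hE.isProjectiveOver
  haveI := hemb
  have hP : IsSmoothProjective N (Motives.projectiveSpace N ℂ) := isSmoothProjective_projectiveSpace' N
  obtain ⟨h, hhrat, hh⟩ := exists_isRationalClass_forall_eq_smul_projectiveSpace N
  refine ⟨complexBetti.map emb 2 h, hhrat.map (Motives.AlgPoints.mapContinuous (L := ℂ) emb),
    HodgeBeyondAnchors.map_mem_algebraicClasses_one hP hE emb
      (by rw [algebraicClasses_projectiveSpace_eq_top]; exact Submodule.mem_top), fun hr ι hι ↦ ?_⟩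
  haveI := hι
  have hN : 1 ≤ N := le_trans (show 1 ≤ n + r by omega) (le_of_isClosedImmersion_projectiveSpace hE emb)
  have h1 : Module.finrank ℂ (complexBetti (Motives.projectiveSpace N ℂ) 2) = 1 :=
    finrank_complexBetti_projectiveSpace_two_mul_eq_one N (p := 1) hN
  haveI : Nontrivial (complexBetti (Motives.projectiveSpace N ℂ) 2) := Module.nontrivial_of_finrank_eq_succ h1
  obtain ⟨c, hc⟩ := exists_ne (0 : complexBetti (Motives.projectiveSpace N ℂ) 2)
  have hh0 : h ≠ 0 := by
    rintro rfl
    obtain ⟨z, hz⟩ := hh c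
    exact hc (by rw [hz, smul_zero])
  exact ZariskiProjectiveBundle.map_two_ne_zero_of_isClosedImmersion hr emb hh0 ι

/-- **PB-LH, direction `HC(X) ⇒ HC(E)`.** For a Zariski-locally trivial `ℙʳ`-bundle `q : E ⟶ X` of
smooth projective varieties (`dim X = n`, `dim E = n + r`) on which the cup product preserves Hodge types,
`HodgeConjectureFor n X → HodgeConjectureFor (n + r) E`. [cite: VoisinHodgeI2002, §7.3.3 Lemma 7.32]
[cite: Lazarsfeld2004PositivityII, Ex. 7.1.5 (7.5)] -/
theorem hodgeConjectureFor_projectiveBundle {n r : ℕ} {X E : SchemeOver ℂ} (q : E ⟶ X)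
    (hX : IsSmoothProjective n X) (hE : IsSmoothProjective (n + r) E)
    (htriv : IsZariskiProjectiveBundle r q) (hcup : CupPreservesHodgeType (n + r) E)
    (hXHC : HodgeConjectureFor n X) : HodgeConjectureFor (n + r) E := by
  classical
  obtain ⟨ζ, hζrat, hζalg, hζres⟩ := exists_isRationalClass_lhClass (n := n) (r := r) hE
  have hζ11 : IsOfHodgeType (n + r) E 2 1 1 ζ :=
    isOfHodgeType_of_mem_algebraicClasses_of_isSmoothProjective hE 1 hζalg
  -- `ζʲ` is of Hodge type `(j, j)`
  have hζpow : ∀ j : ℕ, IsOfHodgeType (n + r) E (2 * j) j j (cupPowTwo ζ j) := by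
    intro j
    induction j with
    | zero =>
      exact isOfHodgeType_of_mem_algebraicClasses_of_isSmoothProjective hE 0
        (by rw [cupPowTwo_zero, algebraicClasses_zero]; exact Submodule.mem_top)
    | succ j ih =>
      rw [cupPowTwo_succ]
      exact hcup (two_mul_add_two j) ih hζ11
  refine ⟨nonempty_hodgeModel_holds hE, fun p y hy hpp ↦ ?_⟩
  -- Leray–Hirsch expansion of `y`, reordered as `Σ_b q^* x_b ∪ ζᵇ`
  obtain ⟨x, hx⟩ := BundleLerayHirsch.exists_expansion q hX htriv ζ hζres p y
  have hBp : min r p + 1 ≤ p + 1 := by omega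
  have e : y = ∑ b : Fin (min r p + 1),
      cupProduct (Summit.HodgeConjecture.HodgeConjecture.Theorems.two_mul_sub_add p hBp b)
        (complexBetti.map q (2 * (p - (b : ℕ))) (x b)) (cupPowTwo ζ b) := by
    rw [hx]
    refine Finset.sum_congr rfl fun b _ ↦ ?_
    rw [cupProduct_gradedComm_holds ℂ (Motives.ComplexPoints E)
        (show 2 * (b : ℕ) + 2 * (p - (b : ℕ)) = 2 * p by omega)
        (Summit.HodgeConjecture.HodgeConjecture.Theorems.two_mul_sub_add p hBp b),
      cupPow_eq_cupPowTwo,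
      show ((-1 : ℂ) ^ (2 * (b : ℕ) * (2 * (p - (b : ℕ))))) = 1 from
        Even.neg_one_pow ⟨(b : ℕ) * (2 * (p - (b : ℕ))), by ring⟩, one_smul]
  -- the rational Hodge maps `G_b = q^*(·) ∪ ζᵇ : H^{2(p-b)}(X) → H^{2p}(E)`
  let G : ∀ b : Fin (min r p + 1), complexBetti X (2 * (p - (b : ℕ))) →ₗ[ℂ] complexBetti E (2 * p) :=
    fun b ↦ (cupProduct (Summit.HodgeConjecture.HodgeConjecture.Theorems.two_mul_sub_add p hBp b)).flip
        (cupPowTwo ζ b) ∘ₗ (complexBetti.map q (2 * (p - (b : ℕ)))).hom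
  have hG : ∀ (b : Fin (min r p + 1)) (u : complexBetti X (2 * (p - (b : ℕ)))),
      G b u = cupProduct (Summit.HodgeConjecture.HodgeConjecture.Theorems.two_mul_sub_add p hBp b)
        (complexBetti.map q (2 * (p - (b : ℕ))) u) (cupPowTwo ζ b) := fun b u ↦ rfl
  obtain ⟨a, ha, hya⟩ := exists_isRationalClass_isOfHodgeType_eq_sum hE (ι := Fin (min r p + 1))
    (m := fun _ ↦ n) (d := fun b ↦ p - (b : ℕ)) (Y := fun _ ↦ X) (fun _ ↦ hX) p (fun b ↦ (b : ℕ))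
    (fun b ↦ by have := b.2; show p - (b : ℕ) + b = p; omega) G
    (fun b u hu ↦ by
      rw [hG]; exact (hu.map (Motives.AlgPoints.mapContinuous (L := ℂ) q)).cup _ (hζrat.cupPowTwo b))
    (fun b a' c' u _ hu ↦ by rw [hG]; exact hcup _ (hu.map_of_isSmoothProjective hE hX q) (hζpow b))
    hy hpp (by rw [e]; exact Submodule.sum_mem _ fun b _ ↦
      Submodule.mem_iSup_of_mem b (LinearMap.mem_range.2 ⟨x b, rfl⟩))
  rw [hya]
  refine Submodule.sum_mem _ fun b _ ↦ ?_
  rw [hG]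
  have halg : a b ∈ algebraicClasses X (p - (b : ℕ)) := hXHC.2 _ _ (ha b).1 (ha b).2
  exact cupProduct_cupPowTwo_mem_algebraicClasses hE hζalg
    (fulton1998_map_mem_algebraicClasses_holds q hX hE _ _ halg) b (by have := b.2; omega) _

/-- **PB-LH, direction `HC(E) ⇒ HC(X)`** (no Hodge-type hypothesis): `q^* x₀` is rational of type
`(p,p)`, hence algebraic on `E`, and the Leray–Hirsch readout with one term (`b = 0`: the projection
formula `q_*(q^* x₀ ∪ ζʳ) = λ x₀`, `λ ≠ 0`, tree `lerayHirschCoeff_mem_algebraicClasses`) returns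
`x₀ ∈ Nᵖ`. [cite: Fulton1998, Thm. 3.3 (b)] [cite: VoisinHodgeI2002, Lemma 7.32] -/
theorem hodgeConjectureFor_of_projectiveBundle {n r : ℕ} {X E : SchemeOver ℂ} (q : E ⟶ X)
    (hX : IsSmoothProjective n X) (hE : IsSmoothProjective (n + r) E)
    (htriv : IsZariskiProjectiveBundle r q) (hEHC : HodgeConjectureFor (n + r) E) :
    HodgeConjectureFor n X := by
  classical
  obtain ⟨ζ, -, hζalg, hζres⟩ := exists_isRationalClass_lhClass (n := n) (r := r) hE
  let μ : OrientationFamily := fun _ _ hW ↦ (Motives.ComplexPoints.isOrientableOver ℂ hW).some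
  obtain ⟨lam, hlam0, hlam⟩ := BundleLerayHirsch.exists_complexGysin_cupPow_eq q hX hE htriv ζ hζres μ
  rw [cupPow_eq_cupPowTwo] at hlam
  have hconiv : ∀ (c : ℕ), ∀ x ∈ algebraicClasses X c,
      complexBetti.map q (2 * c) x ∈ algebraicClasses E c :=
    fun c x hx ↦ fulton1998_map_mem_algebraicClasses_holds q hX hE c x hx
  refine ⟨nonempty_hodgeModel_holds hX, fun p x₀ hx₀ hpp ↦ ?_⟩
  -- `q^* x₀` is algebraic on `E`
  have hq : complexBetti.map q (2 * p) x₀ ∈ algebraicClasses E p :=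
    hEHC.2 p _ (hx₀.map (Motives.AlgPoints.mapContinuous (L := ℂ) q)) (hpp.map_of_isSmoothProjective hE hX q)
  -- readout with the single coefficient `x 0 = x₀`
  let x : (b : Fin 1) → complexBetti X (2 * (p - (b : ℕ))) := fun b ↦
    Fin.cases (motive := fun b : Fin 1 ↦ complexBetti X (2 * (p - (b : ℕ)))) x₀ (fun i ↦ i.elim0) b
  have hBp : 1 ≤ p + 1 := by omega
  have hy : (∑ b : Fin 1, cupProduct (Summit.HodgeConjecture.HodgeConjecture.Theorems.two_mul_sub_add p hBp b)
      (complexBetti.map q (2 * (p - (b : ℕ))) (x b)) (cupPowTwo ζ b)) ∈ algebraicClasses E p := by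
    rw [Fin.sum_univ_one]
    exact cupProduct_cupPowTwo_mem_algebraicClasses hE hζalg hq 0 (by omega) _
  have key := Summit.HodgeConjecture.HodgeConjecture.Theorems.lerayHirschCoeff_mem_algebraicClasses μ hX hE q
    hζalg hconiv hlam0 hlam hBp (by omega) x hy 0
  exact key

/-- **PB-LH (both directions), granted that the cup product preserves Hodge types on `E`.** -/
theorem hodgeConjectureFor_projectiveBundle_iff {n r : ℕ} {X E : SchemeOver ℂ} (q : E ⟶ X)
    (hX : IsSmoothProjective n X) (hE : IsSmoothProjective (n + r) E)
    (htriv : IsZariskiProjectiveBundle r q) (hcup : CupPreservesHodgeType (n + r) E) :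
    HodgeConjectureFor n X ↔ HodgeConjectureFor (n + r) E :=
  ⟨hodgeConjectureFor_projectiveBundle q hX hE htriv hcup, hodgeConjectureFor_of_projectiveBundle q hX hE htriv⟩

/-- **PB-LH, UNCONDITIONAL (the closure rule `ProjectiveBundleClosure` of `ROUTE-P1Q-Sketch-PB.lean`): the
Hodge conjecture is invariant under Zariski-locally trivial `ℙʳ`-bundles of smooth projective complex
varieties.** The cup product preserves Hodge types on every smooth projective variety
(`cupPreservesHodgeType_of_hodgeModel`, from de Rham's theorem `exists_deRhamIsoFamily_holds` and
the Hodge model `nonempty_hodgeModel_holds`). Relies on: nothing unproved.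
[cite: VoisinHodgeI2002, §7.3.3 Lemma 7.32] [cite: Lazarsfeld2004PositivityII, Ex. 7.1.5 (7.5)]
[cite: Fulton1998, Thm. 3.3 (b)] -/
theorem projectiveBundleClosure {n r : ℕ} {X E : SchemeOver ℂ} (q : E ⟶ X)
    (hX : IsSmoothProjective n X) (hE : IsSmoothProjective (n + r) E)
    (htriv : IsZariskiProjectiveBundle r q) :
    HodgeConjectureFor n X ↔ HodgeConjectureFor (n + r) E :=
  hodgeConjectureFor_projectiveBundle_iff q hX hE htriv
    (cupPreservesHodgeType_of_hodgeModel hE (Classical.choice (nonempty_hodgeModel_holds hE)))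

/-! ### Rungs (corollaries): new unconditional HC cases of arbitrary dimension -/

/-- **RUNG PB-≤3: every Zariski-locally trivial `ℙʳ`-bundle over a curve, surface or threefold satisfies
the Hodge conjecture** (any `r`, so any dimension `n + r`). [cite: VoisinHodgeII2003, §10.2.3 Prop. 10.26]
[cite: VoisinHodgeI2002, Lemma 7.32] -/
theorem hodgeConjectureFor_projectiveBundle_of_le_three {n r : ℕ} {X E : SchemeOver ℂ} (q : E ⟶ X)
    (hX : IsSmoothProjective n X) (hE : IsSmoothProjective (n + r) E) (htriv : IsZariskiProjectiveBundle r q)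
    (hn : n ≤ 3) : HodgeConjectureFor (n + r) E :=
  (projectiveBundleClosure q hX hE htriv).1 (hodgeConjectureFor_of_dim_le_three_holds hn hX)

/-- **RUNG PB-ℙ: every Zariski-locally trivial `ℙʳ`-bundle over `ℙᴺ` satisfies the Hodge conjecture**
(tree `hodgeConjectureFor_projectiveSpace`). [cite: VoisinHodgeI2002, Lemma 7.32] -/
theorem hodgeConjectureFor_projectiveBundle_projectiveSpace {N r : ℕ} {E : SchemeOver ℂ}
    (q : E ⟶ Motives.projectiveSpace N ℂ) (hE : IsSmoothProjective (N + r) E)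
    (htriv : IsZariskiProjectiveBundle r q) : HodgeConjectureFor (N + r) E :=
  (projectiveBundleClosure q (isSmoothProjective_projectiveSpace' N) hE htriv).1
    (hodgeConjectureFor_projectiveSpace N)

/-- **RUNG PB-tower: a two-step tower of Zariski projective bundles `E₂ → E₁ → X` over a base with HC
satisfies HC** (iterate for Bott–Samelson-type towers). [cite: VoisinHodgeI2002, Lemma 7.32] -/
theorem hodgeConjectureFor_projectiveBundle_tower₂ {n r₁ r₂ : ℕ} {X E₁ E₂ : SchemeOver ℂ}
    (q₁ : E₁ ⟶ X) (q₂ : E₂ ⟶ E₁) (hX : IsSmoothProjective n X) (hE₁ : IsSmoothProjective (n + r₁) E₁)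
    (hE₂ : IsSmoothProjective (n + r₁ + r₂) E₂) (h₁ : IsZariskiProjectiveBundle r₁ q₁)
    (h₂ : IsZariskiProjectiveBundle r₂ q₂) (hXHC : HodgeConjectureFor n X) :
    HodgeConjectureFor (n + r₁ + r₂) E₂ :=
  (projectiveBundleClosure q₂ hE₁ hE₂ h₂).1 ((projectiveBundleClosure q₁ hX hE₁ h₁).1 hXHC)

/-- **RUNG PB-descent: HC descends from the total space of a Zariski projective bundle to its base**
(e.g. from a flag bundle / projectivised vector bundle to the variety). [cite: Fulton1998, Thm. 3.3 (b)] -/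
theorem hodgeConjectureFor_base_of_projectiveBundle {n r : ℕ} {X E : SchemeOver ℂ} (q : E ⟶ X)
    (hX : IsSmoothProjective n X) (hE : IsSmoothProjective (n + r) E) (htriv : IsZariskiProjectiveBundle r q)
    (hEHC : HodgeConjectureFor (n + r) E) : HodgeConjectureFor n X :=
  hodgeConjectureFor_of_projectiveBundle q hX hE htriv hEHC

/-! ### §HOM  Homogeneous / cellular ambients and bases (chapter HOM of the P1 index; modulo Fulton Ex. 19.1.11) -/

section HOM

open Literature.AlgebraicGeometry.Motives.FanoPlanes
open Literature.AlgebraicGeometry.HodgeTheory.HypersurfaceSectionHC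

/-- **RUNG PB-cell: a Zariski `ℙʳ`-bundle over a smooth projective CELLULAR variety satisfies HC**
(modulo [Fulton1998, Ex. 19.1.11 (b)] as the named fact `Fulton1998_algebraicClasses_eq_top_of_cellular`). -/
theorem hodgeConjectureFor_projectiveBundle_of_hasCellularDecomposition
    (hF : Fulton1998_algebraicClasses_eq_top_of_cellular) {n r : ℕ} {X E : SchemeOver ℂ} (q : E ⟶ X)
    (hX : IsSmoothProjective n X) (hE : IsSmoothProjective (n + r) E) (htriv : IsZariskiProjectiveBundle r q)
    (hc : HasCellularDecomposition X) : HodgeConjectureFor (n + r) E :=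
  (projectiveBundleClosure q hX hE htriv).1 (hodgeConjectureFor_of_hasCellularDecomposition hF hX hc)

/-- **RUNG PB-Gr: a Zariski `ℙˢ`-bundle over a Grassmannian `𝔾(r, n)` satisfies HC** (modulo
[Fulton1998, Ex. 19.1.11 (d)] as `Fulton1998_algebraicClasses_grassmannian_eq_top`, and smooth projectivity
of the Plücker model carried as the hypothesis `hG`). -/
theorem hodgeConjectureFor_projectiveBundle_grassmannian
    (hF : Fulton1998_algebraicClasses_grassmannian_eq_top) {r n N s : ℕ} (hrn : r ≤ n) {E : SchemeOver ℂ}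
    (q : E ⟶ grassmannian r n ℂ) (hG : IsSmoothProjective N (grassmannian r n ℂ))
    (hE : IsSmoothProjective (N + s) E) (htriv : IsZariskiProjectiveBundle s q) :
    HodgeConjectureFor (N + s) E :=
  (projectiveBundleClosure q hG hE htriv).1 (hodgeConjectureFor_grassmannian hF hrn hG)

/-- **RUNG HOM-odd (cellular ambient): an odd-dimensional smooth projective `Y` with a weak Lefschetz
package `g : Y ⟶ X` (`g^*` bijective on `H²ᵖ`, `2p < dim Y`) into a smooth projective CELLULAR `X`
satisfies HC** — e.g. smooth complete intersections / zero loci of ample bundles of odd dimension in flag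
varieties, once the package is supplied (Sommese–Lazarsfeld 7.1.1). Modulo Fulton Ex. 19.1.11 (b).
[cite: VoisinHodgeII2003, §1.2.2 Thm. 1.23] [cite: Lazarsfeld2004PositivityII, Thm. 7.1.1] -/
theorem hodgeConjectureFor_of_lefschetzPackage_odd_cellular
    (hF : Fulton1998_algebraicClasses_eq_top_of_cellular) {m n : ℕ} {X Y : SchemeOver ℂ}
    (hX : IsSmoothProjective n X) (hc : HasCellularDecomposition X) (hY : IsSmoothProjective m Y)
    (g : Y ⟶ X) (hm : Odd m)
    (hbij : ∀ p : ℕ, 2 * p < m → Function.Bijective (complexBetti.map g (2 * p))) :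
    HodgeConjectureFor m Y :=
  hodgeConjectureFor_of_lefschetzPackage_odd fulton1998_map_mem_algebraicClasses_holds hX hY g hm hbij
    fun p _ c₀ _ _ ↦ mem_algebraicClasses_of_hasCellularDecomposition hF hX hc p c₀

/-- **RUNG HOM-even (cellular ambient): even-dimensional `Y` (dim `2k`) with `g^*` bijective below the
middle, injective in the middle, and (VG) every rational `(k,k)` class of `Y` in the range of `g^*`, into a
smooth projective CELLULAR `X`, satisfies HC.** Modulo Fulton Ex. 19.1.11 (b).
[cite: Voisin2013HodgeLociSurvey, §4.3 Thm. 4.17, Rem. 4.18] -/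
theorem hodgeConjectureFor_of_lefschetzPackage_even_cellular
    (hF : Fulton1998_algebraicClasses_eq_top_of_cellular) {k n : ℕ} {X Y : SchemeOver ℂ}
    (hX : IsSmoothProjective n X) (hc : HasCellularDecomposition X) (hY : IsSmoothProjective (2 * k) Y)
    (g : Y ⟶ X) (hbij : ∀ p : ℕ, 2 * p < 2 * k → Function.Bijective (complexBetti.map g (2 * p)))
    (hinj : Function.Injective (complexBetti.map g (2 * k)))
    (hVG : ∀ c : complexBetti Y (2 * k), IsRationalClass c → IsOfHodgeType (2 * k) Y (2 * k) k k c →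
      c ∈ LinearMap.range (complexBetti.map g (2 * k)).hom) :
    HodgeConjectureFor (2 * k) Y :=
  hodgeConjectureFor_of_lefschetzPackage_even fulton1998_map_mem_algebraicClasses_holds hX hY g hbij hinj
    hVG fun p _ c₀ _ _ ↦ mem_algebraicClasses_of_hasCellularDecomposition hF hX hc p c₀

/-- **RUNG HOM-odd (Grassmannian ambient)**: as `hodgeConjectureFor_of_lefschetzPackage_odd_cellular` with
`X = 𝔾(r, n)` (Plücker model), modulo Fulton Ex. 19.1.11 (d). E.g. odd-dimensional smooth zero loci of
ample bundles on Grassmannians once the Sommese package is supplied. -/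
theorem hodgeConjectureFor_of_lefschetzPackage_odd_grassmannian
    (hF : Fulton1998_algebraicClasses_grassmannian_eq_top) {r n N m : ℕ} (hrn : r ≤ n)
    (hG : IsSmoothProjective N (grassmannian r n ℂ)) {Y : SchemeOver ℂ} (hY : IsSmoothProjective m Y)
    (g : Y ⟶ grassmannian r n ℂ) (hm : Odd m)
    (hbij : ∀ p : ℕ, 2 * p < m → Function.Bijective (complexBetti.map g (2 * p))) :
    HodgeConjectureFor m Y :=
  hodgeConjectureFor_of_lefschetzPackage_odd fulton1998_map_mem_algebraicClasses_holds hG hY g hm hbij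
    fun p _ c₀ _ _ ↦ mem_algebraicClasses_grassmannian hF hrn p c₀

/-- **RUNG HOM-even (Grassmannian ambient)**: as `hodgeConjectureFor_of_lefschetzPackage_even_cellular`
with `X = 𝔾(r, n)`, modulo Fulton Ex. 19.1.11 (d). -/
theorem hodgeConjectureFor_of_lefschetzPackage_even_grassmannian
    (hF : Fulton1998_algebraicClasses_grassmannian_eq_top) {r n N k : ℕ} (hrn : r ≤ n)
    (hG : IsSmoothProjective N (grassmannian r n ℂ)) {Y : SchemeOver ℂ} (hY : IsSmoothProjective (2 * k) Y)
    (g : Y ⟶ grassmannian r n ℂ)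
    (hbij : ∀ p : ℕ, 2 * p < 2 * k → Function.Bijective (complexBetti.map g (2 * p)))
    (hinj : Function.Injective (complexBetti.map g (2 * k)))
    (hVG : ∀ c : complexBetti Y (2 * k), IsRationalClass c → IsOfHodgeType (2 * k) Y (2 * k) k k c →
      c ∈ LinearMap.range (complexBetti.map g (2 * k)).hom) :
    HodgeConjectureFor (2 * k) Y :=
  hodgeConjectureFor_of_lefschetzPackage_even fulton1998_map_mem_algebraicClasses_holds hG hY g hbij hinj
    hVG fun p _ c₀ _ _ ↦ mem_algebraicClasses_grassmannian hF hrn p c₀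

end HOM

/-! ### §NV  Non-vacuity of the bundle clause (the tree's `isZariskiProjectiveBundle_fst`): the consistency check `HC(X) ⟺ HC(X × ℙʳ)` -/

section NonVacuity

/-- **Consistency check (row CL7/CL8 recovered): `HC(X) ⟺ HC(X × ℙʳ)`** from `projectiveBundleClosure`
applied to the trivial bundle `fst : X ⊗ ℙʳ ⟶ X` (`isZariskiProjectiveBundle_fst`, tree).
[cite: VoisinHodgeI2002, Thm. 11.38 (Künneth) and Lemma 7.32] -/
theorem hodgeConjectureFor_tensor_projectiveSpace_iff {n : ℕ} (r : ℕ) {X : SchemeOver ℂ}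
    (hX : IsSmoothProjective n X) :
    HodgeConjectureFor n X ↔ HodgeConjectureFor (n + r) (X ⊗ Motives.projectiveSpace r ℂ) :=
  projectiveBundleClosure (fst X (Motives.projectiveSpace r ℂ)) hX
    (IsSmoothProjective.tensor_holds hX (isSmoothProjective_projectiveSpace' r))
    (isZariskiProjectiveBundle_fst X r)

end NonVacuity

end Summit.HodgeConjecture.HodgeConjecture.Theorems.ProjectiveBundleHC
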